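import Summits.Ventures.HodgeRepro2.T6Host
import Summits.Ventures.HodgeRepro2.T6HostBetti

/-!
# T6HostHodge — the Hodge pieces of `Bd` on `HC` and the lead's discharge of `hT` / `hcA` / `hcB`

Cell pub-hodge-repro2, Tier 6 (README §10), seat t6-lead (g4). Definition lane + proof lane, host-side
(TARGET-T6.md §2 Layer III; STATUS ll. 10948 (2), 11001 (3)).

* `isoC Bd X k` / `hodgeHC Bd hX k p q` — the base change of `Bd.isoObj X k` and the `(p,q)`-piece of
  `Bd.hodge hX k` transported to `HC X k = ℂ ⊗ H^k(X(ℂ), ℚ)` (t6-p1's definitions of STATUS l. 10992, moved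
  here verbatim so that the lead's discharge lemmas and the A1 consumer (`T6A1HostBetti.factorIdentHC`)
  name ONE object);
* `complexConj_hodgeHC` — `conj H^{p,q} = H^{q,p}` on `HC` (the host's `HodgeStructure.complexConj_piece`
  through `isoC`);
* `isCompl_hodgeHC_one` — `H¹ = H^{1,0} ⊕ H^{0,1}` on `HC` from clause (c) of `T6HostBetti`
  (= t6-p1's binders `hcA` / `hcB`);
* `CoeffNatural coeffC` — the naturality of the coefficient map `coeffC` under pull-backs (the shape
  t6-p2's `HostCoeff.map_coeffC_one_tmul` + `coeffC_ext` prove for `HostCoeff.coeffC`);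
* `eigC_le_hodgeHC_of_mem_type` / `mem_type_of_eigC_le` / `hT_of_clauses` — for a `CMVariety K` with a CM
  type (the tree's `IsCMType`), `σ ∈ type ↔ H¹_σ ⊆ H^{1,0}` on `HC`, from clause (a) (the `(1,0)`-piece of
  `Bd` is the host's `IsOfHodgeType … 1 1 0`, read through `coeffC`), clause (c) and `finrank_eig`
  (= t6-p1's binder `hT`). No injectivity of `coeffC` is used.

No `sorry`; standard axioms.
§8(d): uses an L-value-free non-vanishing device: NO.
-/

noncomputable section

open CategoryTheory
open scoped TensorProduct
open HostAPI.Carriers.AlgebraicGeometry.Motives HostAPI.Carriers.AlgebraicGeometry.HodgeTheory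

namespace Summit.Ventures.HodgeRepro2.T6.Host

section hodge

variable (Bd : BettiHodgeData ℂ)

/-- The base change of `Bd.isoObj X k : Bd.W.obj X k ≃ₗ[ℚ] H^k(X(ℂ), ℚ)` (t6-p1, l. 10992). -/
abbrev isoC (X : SchemeOver ℂ) (k : ℕ) : ℂ ⊗[ℚ] Bd.W.obj X k ≃ₗ[ℂ] HC X k :=
  (Bd.isoObj X k).baseChange ℚ ℂ _ _

/-- `isoC` applied to a tensor is the base change of the Betti datum's isomorphism `isoObj`. -/
theorem isoC_apply (X : SchemeOver ℂ) (k : ℕ) (u : ℂ ⊗[ℚ] Bd.W.obj X k) :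
    isoC Bd X k u = (Bd.isoObj X k).toLinearMap.baseChange ℂ u := by
  induction u using TensorProduct.induction_on with
  | zero => simp
  | tmul a v => simp
  | add x y hx hy => simp [map_add, hx, hy]

/-- `isoC` commutes with the complex-conjugation structure of the base-changed Hodge structure. -/
theorem conj_isoC (X : SchemeOver ℂ) (k : ℕ) (u : ℂ ⊗[ℚ] Bd.W.obj X k) :
    HodgeStructure.conj (isoC Bd X k u) = isoC Bd X k (HodgeStructure.conj u) := by
  rw [isoC_apply, isoC_apply, HodgeStructure.conj_baseChange]

/-- The inverse of `isoC` commutes with complex conjugation (transport of `conj_isoC`). -/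
theorem conj_isoC_symm (X : SchemeOver ℂ) (k : ℕ) (w : HC X k) :
    HodgeStructure.conj ((isoC Bd X k).symm w) = (isoC Bd X k).symm (HodgeStructure.conj w) := by
  apply (isoC Bd X k).injective
  rw [← conj_isoC, LinearEquiv.apply_symm_apply, LinearEquiv.apply_symm_apply]

/-- THE `(p,q)`-PIECE of `H^k(X(ℂ), ℂ) = ℂ ⊗ H^k(X(ℂ), ℚ)` read from `Bd` and transported along `isoObj`
(t6-p1, l. 10992). -/
def hodgeHC {n : ℕ} {X : SchemeOver ℂ} (hX : IsSmoothProjective n X) (k : ℕ) (p q : ℤ) :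
    Submodule ℂ (HC X k) :=
  ((Bd.hodge hX k).piece p q).map (isoC Bd X k).toLinearMap

/-- Membership in the transported Hodge piece `hodgeHC` is membership of the `isoC`-preimage in the datum's piece. -/
theorem mem_hodgeHC_iff {n : ℕ} {X : SchemeOver ℂ} (hX : IsSmoothProjective n X) (k : ℕ) (p q : ℤ)
    (w : HC X k) :
    w ∈ hodgeHC Bd hX k p q ↔ (isoC Bd X k).symm w ∈ (Bd.hodge hX k).piece p q := by
  unfold hodgeHC
  rw [Submodule.map_equiv_eq_comap_symm, Submodule.mem_comap]
  rfl

/-- `isoC u` lies in the transported piece iff `u` lies in the datum's piece (`mem_hodgeHC_iff` + `symm_apply_apply`). -/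
theorem isoC_mem_hodgeHC_iff {n : ℕ} {X : SchemeOver ℂ} (hX : IsSmoothProjective n X) (k : ℕ) (p q : ℤ)
    (u : ℂ ⊗[ℚ] Bd.W.obj X k) :
    isoC Bd X k u ∈ hodgeHC Bd hX k p q ↔ u ∈ (Bd.hodge hX k).piece p q := by
  rw [mem_hodgeHC_iff, LinearEquiv.symm_apply_apply]

/-- `conj H^{p,q} = H^{q,p}` on `HC` (Voisin I Cor. 6.12 in the host's words, `complexConj_piece`). -/
theorem complexConj_hodgeHC {n : ℕ} {X : SchemeOver ℂ} (hX : IsSmoothProjective n X) (k : ℕ) (p q : ℤ) :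
    HodgeStructure.complexConj (hodgeHC Bd hX k p q) = hodgeHC Bd hX k q p := by
  ext w
  rw [HodgeStructure.mem_complexConj, mem_hodgeHC_iff, mem_hodgeHC_iff, ← HodgeStructure.complexConj_piece,
    HodgeStructure.mem_complexConj, conj_isoC_symm, HodgeStructure.conj_conj]

/-- `H¹ = H^{1,0} ⊕ H^{0,1}` on the Weil-cohomology side, from clause (c) at `k = 1`. -/
theorem isCompl_piece_one_of_decomp (hc : BettiClausesDecomp Bd) {n : ℕ} {X : SchemeOver ℂ}
    (hX : IsSmoothProjective n X) :
    IsCompl ((Bd.hodge hX 1).piece 1 0) ((Bd.hodge hX 1).piece 0 1) := by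
  have h := hc hX 1
  have hi : ((1, 0) : ℕ × ℕ) ∈ Finset.HasAntidiagonal.antidiagonal 1 := by
    simp [Finset.HasAntidiagonal.mem_antidiagonal]
  have hj : ((0, 1) : ℕ × ℕ) ∈ Finset.HasAntidiagonal.antidiagonal 1 := by
    simp [Finset.HasAntidiagonal.mem_antidiagonal]
  rw [DirectSum.isInternal_submodule_iff_isCompl (i := ⟨(1, 0), hi⟩) (j := ⟨(0, 1), hj⟩)] at h
  · simpa using h
  · simp
  · ext ⟨⟨a, b⟩, hab⟩
    simp only [Set.mem_univ, Set.mem_insert_iff, Set.mem_singleton_iff, Subtype.mk.injEq,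
      Prod.mk.injEq, true_iff]
    rw [Finset.HasAntidiagonal.mem_antidiagonal] at hab
    omega

/-- `H¹ = H^{1,0} ⊕ H^{0,1}` on `HC X 1`, from clause (c) (t6-p1's `hcA` at each factor, `hcB` at `B`). -/
theorem isCompl_hodgeHC_one (hc : BettiClausesDecomp Bd) {n : ℕ} {X : SchemeOver ℂ}
    (hX : IsSmoothProjective n X) :
    IsCompl (hodgeHC Bd hX 1 1 0) (hodgeHC Bd hX 1 0 1) := by
  have h := (Submodule.orderIsoMapComap (isoC Bd X 1)).isCompl (isCompl_piece_one_of_decomp Bd hc hX)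
  unfold hodgeHC
  simpa only [Submodule.orderIsoMapComap_apply] using h

end hodge

section eigen

/-- `baseChangeAct act x` is the base change of `act x`. -/
theorem baseChangeAct_apply {M V : Type} [Field M] [AddCommGroup V] [Module ℚ V]
    (act : M →+* Module.End ℚ V) (x : M) : baseChangeAct act x = (act x).baseChange ℂ := rfl

/-- Membership in the eigen-subspace `eigSub act τ`: `v` is a simultaneous eigenvector with eigencharacter `τ`. -/
theorem mem_eigSub_iff {𝕜 M V : Type} [Field 𝕜] [Field M] [AddCommGroup V] [Module 𝕜 V]
    (act : M →+* Module.End 𝕜 V) (τ : M →+* 𝕜) (v : V) :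
    v ∈ eigSub act τ ↔ ∀ x : M, act x v = τ x • v := by
  unfold eigSub
  rw [Submodule.mem_iInf]
  exact forall_congr' fun x => Module.End.mem_eigenspace_iff

/-- Complex conjugation carries the `σ`-eigenspace of a complexified rational action into the
`σ̄`-eigenspace (`conj (σ(x) • w) = σ̄(x) • conj w`). -/
theorem conj_mem_eigC {M : Type} [Field M] {X : SchemeOver ℂ} {i : ℕ}
    (act : M →+* Module.End ℚ (HQ X i)) (σ : M →+* ℂ) {w : HC X i} (hw : w ∈ eigC act σ) :
    HodgeStructure.conj w ∈ eigC act (NumberField.ComplexEmbedding.conjugate σ) := by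
  rw [eigC, mem_eigSub_iff] at hw ⊢
  intro x
  rw [baseChangeAct_apply, ← HodgeStructure.conj_baseChange, ← baseChangeAct_apply, hw x,
    HodgeStructure.conj_smul, NumberField.ComplexEmbedding.conjugate_coe_eq]

/-- Complex conjugation carries the `σ`-eigenspace into the `σ̄`-eigenspace (the CM-type conjugation law on the complexified Betti space). -/
theorem eigC_le_complexConj_eigC {M : Type} [Field M] {X : SchemeOver ℂ} {i : ℕ}
    (act : M →+* Module.End ℚ (HQ X i)) (σ : M →+* ℂ) :
    eigC act σ ≤ HodgeStructure.complexConj (eigC act (NumberField.ComplexEmbedding.conjugate σ)) := by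
  intro w hw
  rw [HodgeStructure.mem_complexConj]
  exact conj_mem_eigC act σ hw

end eigen

section discharge

/-- NATURALITY of a coefficient map `coeffC : HC X k → H X k` under pull-backs: the shape in which t6-p2's
`HostCoeff.map_coeffC_one_tmul` (+ `coeffC_ext`) is consumed here. -/
def CoeffNatural (coeffC : ∀ (X : SchemeOver ℂ) (k : ℕ), HC X k →ₗ[ℂ] H X k) : Prop :=
  ∀ ⦃X Y : SchemeOver ℂ⦄ (f : X ⟶ Y) (k : ℕ) (w : HC Y k),
    coeffC X k ((pullQ f k).baseChange ℂ w) = pull f k (coeffC Y k w)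

variable {K : Type} [Field K] [NumberField K] [NumberField.IsCMField K]
  (coeffC : ∀ (X : SchemeOver ℂ) (k : ℕ), HC X k →ₗ[ℂ] H X k) (Bd : BettiHodgeData ℂ) (A : CMVariety K)

/-- `coeffC` carries a `σ`-eigenvector of the complexified `K`-action into a `σ`-eigenvector of the order
action on `H¹(A(ℂ), ℂ)` (`act_endo` + naturality). -/
theorem coeffC_eigen (hnat : CoeffNatural coeffC) {σ : K →+* ℂ} {w : HC A.A.X 1} (hw : w ∈ eigC A.act σ)
    (x : A.O') : avPull (A.endo x) 1 (coeffC A.A.X 1 w) = σ x • coeffC A.A.X 1 w := by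
  rw [eigC, mem_eigSub_iff] at hw
  have h := hw x
  rw [baseChangeAct_apply, A.act_endo x] at h
  have h' : (pullQ (avHom (A.endo x)) 1).baseChange ℂ w = σ x • w := h
  rw [avPull, ← hnat, h', map_smul]

/-- (⇒) `σ ∈ type → H¹_σ ⊆ H^{1,0}`: clause (a) at the host model supplied by `IsOfHodgeType`. -/
theorem eigC_le_hodgeHC_of_mem_type (hnat : CoeffNatural coeffC) (ha : BettiClausesHodge coeffC Bd)
    {σ : K →+* ℂ} (hσ : σ ∈ A.type) : eigC A.act σ ≤ hodgeHC Bd A.smooth 1 1 0 := by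
  intro w hw
  obtain ⟨hm, hc⟩ := (A.type_spec σ).1 hσ (coeffC A.A.X 1 w) (coeffC_eigen coeffC A hnat hw)
  rw [← LinearEquiv.apply_symm_apply (isoC Bd A.A.X 1) w, isoC_mem_hodgeHC_iff]
  have key := (ha A.smooth hm 1 1 0 ((isoC Bd A.A.X 1).symm w)).2
  simp only [Nat.cast_one, Nat.cast_zero] at key
  apply key
  rw [← isoC_apply, LinearEquiv.apply_symm_apply]
  exact hc

/-- (⇐) `H¹_σ ⊆ H^{1,0} → σ ∈ type` for a CM type: else `σ̄ ∈ type`, so `H¹_σ = conj H¹_σ̄ ⊆ conj H^{1,0}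
= H^{0,1}`, and `H¹_σ ⊆ H^{1,0} ⊓ H^{0,1} = ⊥` (clause (c)) against `finrank_eig`. -/
theorem mem_type_of_eigC_le (hnat : CoeffNatural coeffC) (ha : BettiClausesHodge coeffC Bd)
    (hc : BettiClausesDecomp Bd) (hCM : Summit.Ventures.HodgeRepro2.IsCMType K A.type) {σ : K →+* ℂ}
    (h : eigC A.act σ ≤ hodgeHC Bd A.smooth 1 1 0) : σ ∈ A.type := by
  by_contra hσ
  have hσ' : NumberField.ComplexEmbedding.conjugate σ ∈ A.type := by
    rcases hCM σ with ⟨h1, _⟩ | ⟨h2, _⟩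
    · exact absurd h1 hσ
    · exact h2
  have h1 : eigC A.act σ ≤ hodgeHC Bd A.smooth 1 0 1 := by
    calc eigC A.act σ
        ≤ HodgeStructure.complexConj (eigC A.act (NumberField.ComplexEmbedding.conjugate σ)) :=
          eigC_le_complexConj_eigC A.act σ
      _ ≤ HodgeStructure.complexConj (hodgeHC Bd A.smooth 1 1 0) :=
          HodgeStructure.complexConj_mono (eigC_le_hodgeHC_of_mem_type coeffC Bd A hnat ha hσ')
      _ = hodgeHC Bd A.smooth 1 0 1 := complexConj_hodgeHC Bd A.smooth 1 1 0
  have hbot : eigC A.act σ = ⊥ := by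
    rw [← le_bot_iff, ← (isCompl_hodgeHC_one Bd hc A.smooth).inf_eq_bot]
    exact le_inf h h1
  have := A.finrank_eig σ
  rw [hbot, finrank_bot] at this
  exact absurd this (by norm_num)

/-- t6-p1's binder `hT` (l. 10992), discharged: for every factor of a corner product, `σ ∈ T i ↔ H¹_σ(A_i) ⊆
H^{1,0}(A_i)` on `HC`. -/
theorem hT_of_clauses (hnat : CoeffNatural coeffC) (ha : BettiClausesHodge coeffC Bd)
    (hc : BettiClausesDecomp Bd) (C : CornerProduct K) :
    ∀ (i : Fin 4) (σ : K →+* ℂ), σ ∈ C.F.T i ↔ eigC (C.A i).act σ ≤ hodgeHC Bd (C.A i).smooth 1 1 0 := by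
  intro i σ
  rw [← C.type_factor i]
  exact ⟨eigC_le_hodgeHC_of_mem_type coeffC Bd (C.A i) hnat ha,
    mem_type_of_eigC_le coeffC Bd (C.A i) hnat ha hc ((C.type_factor i).symm ▸ C.F.face.1 i)⟩

end discharge

end Summit.Ventures.HodgeRepro2.T6.Host

end
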